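import Mathlib

/-!
# Stub `stub_subsingleton_of_isCyclic` — a finite cyclic group with the lifting property is trivial

Crux `HeegaardPairFreenessDetection` (stmt-SmoothPoincare4-15157), line `Sketch`, composition
`projective-retract-sieve`, stub S2.  Pure finite group theory: if every homomorphism from the finite
cyclic group `C` to a finite group lifts through every surjection of finite groups (the finite shadow
of "`Ĉ` is a projective profinite group"), then `C` is trivial.  Proof: an element `g` of finite order
`N` dies under every `φ : C → ℤ/n`, because a lift of `φ` through `ℤ/Nn ↠ ℤ/n` sends `g` to an
`N`-torsion element of `ℤ/Nn`, i.e. a multiple of `n` (`s2_map_eq_one_of_isOfFinOrder_of_lift`,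
proof text adapted from the tree lemma
`Literature.Topology.FourManifolds.map_eq_one_of_isOfFinOrder_of_sameFiniteQuotients_freeGroup`);
apply this to the isomorphism `C ≃* ℤ/|C|` (`zmodCyclicMulEquiv`).
-/

noncomputable section

-- the prescribed namespace duplicates SmoothPoincare4 (P = Sub)
set_option linter.dupNamespace false

namespace Summit.SmoothPoincare4.SmoothPoincare4.Theorems.HeegaardPairFreenessDetection.Sieve

universe u

/-- **Torsion is invisible in the finite cyclic quotients of a group with the lifting property**
(finite shadow of "projective profinite groups are torsion-free"): if every homomorphism from `C` to a
finite group lifts through every surjection of finite groups, then every element `g` of finite order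
`N` lies in the kernel of every homomorphism `φ : C → ℤ/n` (`n ≥ 1`).  Proof: lift `φ` through
`ℤ/Nn ↠ ℤ/n`; the image of `g` is an `N`-torsion element of `ℤ/Nn`, i.e. a multiple of `n`, which
reduces to `0`.  (Proof text adapted from the tree lemma
`Literature.Topology.FourManifolds.map_eq_one_of_isOfFinOrder_of_sameFiniteQuotients_freeGroup`.)
[folklore] -/
theorem s2_map_eq_one_of_isOfFinOrder_of_lift {C : Type u} [Group C]
    (hC : ∀ (P E : Type) [Group P] [Finite P] [Group E] [Finite E] (π : C →* P) (ε : E →* P),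
      Function.Surjective ε → ∃ f : C →* E, ε.comp f = π)
    {g : C} (hg : IsOfFinOrder g) {n : ℕ} [NeZero n] (φ : C →* Multiplicative (ZMod n)) :
    φ g = 1 := by
  set N := orderOf g with hN
  have hN0 : N ≠ 0 := (hg.orderOf_pos).ne'
  haveI : NeZero (N * n) := ⟨Nat.mul_ne_zero hN0 (NeZero.ne n)⟩
  -- the reduction `ℤ/Nn ↠ ℤ/n`
  set ε : Multiplicative (ZMod (N * n)) →* Multiplicative (ZMod n) :=
    AddMonoidHom.toMultiplicative (ZMod.castHom (dvd_mul_left n N) (ZMod n)).toAddMonoidHom with hε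
  have hεapp : ∀ a : ℕ, ε (Multiplicative.ofAdd (a : ZMod (N * n))) =
      Multiplicative.ofAdd (a : ZMod n) := fun a => by
    rw [hε, AddMonoidHom.coe_toMultiplicative, Function.comp_apply, Function.comp_apply,
      toAdd_ofAdd, RingHom.toAddMonoidHom_eq_coe, AddMonoidHom.coe_coe, ZMod.castHom_apply,
      ZMod.cast_natCast (dvd_mul_left n N)]
  have hεs : Function.Surjective ε := fun y => by
    refine ⟨Multiplicative.ofAdd ((Multiplicative.toAdd y).val : ZMod (N * n)), ?_⟩
    rw [hεapp, ZMod.natCast_zmod_val, ofAdd_toAdd]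
  obtain ⟨f, hf⟩ := hC _ _ φ ε hεs
  -- `f g` is `N`-torsion in `ℤ/Nn`, hence a multiple of `n`
  have hfg : (f g) ^ N = 1 := by
    rw [← map_pow]
    exact (congrArg f (pow_orderOf_eq_one (x := g))).trans (map_one f)
  set y : ZMod (N * n) := Multiplicative.toAdd (f g) with hy
  have hyN : (N : ZMod (N * n)) * y = 0 := by
    have := congrArg Multiplicative.toAdd hfg
    rwa [toAdd_pow, toAdd_one, nsmul_eq_mul] at this
  have hdvd : n ∣ y.val := by
    have h1 : ((N * y.val : ℕ) : ZMod (N * n)) = 0 := by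
      rw [Nat.cast_mul, ZMod.natCast_zmod_val, hyN]
    have h2 : N * n ∣ N * y.val := (ZMod.natCast_eq_zero_iff _ _).1 h1
    exact Nat.dvd_of_mul_dvd_mul_left (Nat.pos_of_ne_zero hN0) h2
  -- so `φ g = ε (f g) = 0`
  have hφg : φ g = ε (f g) := by rw [← hf, MonoidHom.comp_apply]
  rw [hφg, ← ofAdd_toAdd (f g), ← hy, ← ZMod.natCast_zmod_val y, hεapp,
    (ZMod.natCast_eq_zero_iff _ _).2 hdvd, ofAdd_zero]

/-- **S2 — a finite cyclic group with the lifting property is trivial** (finite shadow of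
"projective profinite groups are torsion-free"): if `C ≅ ℤ/n` with `n > 1`, the isomorphism
`C → ℤ/n` does not lift through `ℤ/n² ↠ ℤ/n` (a lift of a generator is `n`-torsion in `ℤ/n²`, hence a
multiple of `n`, hence dies in `ℤ/n`).  Formally: every `g : C` has finite order, so the isomorphism
`φ : C ≃* ℤ/|C|` (`zmodCyclicMulEquiv`) kills `g` (`s2_map_eq_one_of_isOfFinOrder_of_lift`), whence
`g = 1`. [folklore] -/
theorem stub_subsingleton_of_isCyclic {C : Type u} [Group C] [Finite C] [IsCyclic C]
    (hC : ∀ (P E : Type) [Group P] [Finite P] [Group E] [Finite E] (π : C →* P) (ε : E →* P),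
      Function.Surjective ε → ∃ f : C →* E, ε.comp f = π) : Subsingleton C := by
  haveI : NeZero (Nat.card C) := ⟨Nat.card_pos.ne'⟩
  refine subsingleton_of_forall_eq 1 fun g => ?_
  set e : Multiplicative (ZMod (Nat.card C)) ≃* C := zmodCyclicMulEquiv ‹IsCyclic C› with he
  have h1 : e.symm.toMonoidHom g = 1 :=
    s2_map_eq_one_of_isOfFinOrder_of_lift hC (isOfFinOrder_of_finite g) e.symm.toMonoidHom
  rw [MulEquiv.coe_toMonoidHom] at h1
  rw [← e.apply_symm_apply g, h1, map_one]

end Summit.SmoothPoincare4.SmoothPoincare4.Theorems.HeegaardPairFreenessDetection.Sieve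

end
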